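import Summits.QuantumFields.BalabanUV.T4Continuum.Support.NE7EtaBackgroundAllCutoffs
import Summits.QuantumFields.BalabanUV.T4Continuum.Support.TermwiseLocalThm1LedgerW
import HarnessLib

/-!
# NE7Route1EndDocked — route #1 of the NE7 crux: `CruxDecl_of`'s seam END ∘ node T ∘ NODE O AS ONE KERNEL THEOREM — the term-wise END
# `TermwiseLocalThm1LedgerW.goodClause_summable_UN_levels_of_thm1At_residualW` (p215546 lineage, gen 19) APPLIED at the boundary carrier on
# `NE7EtaBackgroundCarrier.occCarriers`, its four background-side binders `hUR`∕`hURB`∕`hURR`∕`hwit` and their constants `Cr, EB₀, CrR`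
# PRODUCED by `NE7EtaBackgroundAllCutoffs.endTowers_spec_occCarriers_of_hmin_all` (gen 56); what remains is DISPLAYED as the hypothesis list

Cell `pub-balaban`, rung (B)+1 sub-cell t4, lineage `b2b-balaban-t4-ne7-p1`, generation 56 (CRUX PROVER NE7 #1, ruling e34b3e0c (2)); crux
skeleton `t4/skeletons/NE7-CRUX-R1.md` v1.7.15 §2.  HONEST FRAMING (page 1): FIXED FINITE T⁴, rung (B)+1; NE7, NE3 NOT PRINTED in
[Balaban1984PropagatorsI]–[Balaban1989LargeFieldII] and NOT PROVED here; continuum YM on T⁴ ⇐ BetaPertH ∧ nine spine estimates (0/9 proved);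
BetaPertH ⇐ (D1) ∧ (D4) ∧ CAP+tail; G-an2-4 gates asym, D1 and NE2/3/4; NOT infinite volume, NOT mass gap, NOT Clay.

v1.1 = v1 (p317648) with the END's binder loci corrected in comments only (`hfmtA` l.97, `hfmtB` l.102, `hint` l.107, `hoff` l.117, `hS` l.126,
`hRSA` l.148, `hRSB` l.150, `hWw′` l.222, `hURR` l.96 of `TermwiseLocalThm1LedgerW.lean` 2e9b6927386b32b5); the theorem is byte-identical.

WHAT ([folklore]; 0 def; 0 sorry; ONE theorem, two applications).  Until now `CruxDecl_of` = «END ∘ `uRateUpTo_of_nodes` ∘ NODE O» was a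
composition BY NAME (t4-ref2 pass 58 «as outline»; PRICING-NE7 v25.1 §177 (f): «one seam term short until p314477»).  **`goodClause_summable_of_
route1_docked`** states it as ONE term: HYPOTHESES = (A) the gen-55∕56 bill of NODE O's background coordinate — NE3's covariant root (INTERFACE
REQUEST NE7→NE3 amendment 4, ANY real `C, Λ₁, Λ₂′`; X-A4), NE3's (H∃) `hmin`, the closed-form numerics, `hdom`, the sector condition, the
reference datum `v₁ ∈ dom`; (B) node U2's `InjectedRate` on the printed box, the window, the history moduli with `FadingMemory`, the common rate
`θ′ ∈ [θ, 1)`; (C) node U3's shapes (`NE9`∕`LipBackground`∕`PolyLipGrowth`∕`NE5` and their boundary twins) for the SIX ABSTRACT functionals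
`EA EB BA BB RA RB` on the carrier (X-A2); (D) the END's remaining binders VERBATIM (`TermwiseLocalThm1LedgerW` ll.97–242 with `Adm := dom`,
`gB K := gA (K+1) (·+1)`, the data type `ι :=` configurations `Site 4 → Fin 4 → U(n)` with a supplier-CHOSEN `MeasurableSpace` structure — the
tree carries no instance for it —, the carrier's `Dom∕scale∕d∕Fl∕admFl := D∕sc∕dl∕Fl∕admFl`), EXCEPT that the EIGHT binders which read the
selections (`hfmtA`, `hfmtB`, `hint`, `hoff`, `hS`, `hRSA`, `hRSB`, `hWw′`) are asked FOR EVERY selection `uA uB oneA oneB` meeting the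
SPECIFICATION exported by gen 56 ((a) gauge copies of a minimiser pair for the datum itself at EVERY cutoff on `dom ∖ {v₁}`; (b) `oneA`, `oneB`
at `v₁` and off `dom`; the reference backgrounds are the flat configuration at tag `0`) — this is the honest contract of NODE O's functional
half: the coordinate's minimisers come from (H∃) by choice, so a supplier can only use their specification (located: its functionals must not
depend on WHICH minimiser∕gauge copy is selected — e.g. read the background through the orbit, `avgIter`, or supply uniqueness modulo gauge).
CONCLUSION: `∃ δ, GoodClause l₀ vol T A B Bad δ ∧ Summable δ` — the input of the apex seam `NE7Route1ApexSeam.stringwiseMatching_of_route1_end`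
(p309468) on the hybrid cores, per string.  So route 1 reads, in kernel: THIS THEOREM (per string, on the cores) + NE7b∕NE7c weights + the E1∕E2
dictionary ⇒ `T4ApexVariance.StringwiseMatching` (node U5).
HONEST: composition of landed modules; EVERY analytic input is a HYPOTHESIS displayed in the signature (NE3's root and (H∃), NE5∕NE9∕Lipschitz
shapes of three kinds, node U2's rate, B11 `Thm1At` per run, the flow window (0.31) `Discrete031`, the (W-·) residual inputs, the format and
size binders); all functionals and all term data are ABSTRACT; nothing of [I]–[III] is asserted, instantiated or discharged; route 1 stays
KERNEL-COMPLETE AT FORM LEVEL ∕ DEPENDENT; NE7 NOT proved; spine 0∕9.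
-/

set_option autoImplicit false

open scoped BigOperators Matrix Matrix.Norms.L2Operator
open Finset NormedSpace MeasureTheory

namespace Summit.QuantumFields.BalabanUV.T4Continuum.NE7Route1EndDocked

open Literature.MathematicalPhysics.QuantumFieldTheory.Balaban1983to89
open B7Prop1Explicit B7Prop2Explicit B7Prop1Local B11
open T4AveragingDeficitWall hiding Site Plane Plaq Bond
open T4AveragingDeficitWallBoundary (periodBox IsPeriodicCfg)
open MinimalActionSandwich (IsMinimiser)
open MinimalActionRate (Regular sfClass)
open MinimalActionRefine (RegularSup gradConst)
open T4OutputRate (Carriers Functional NE9 NE5 LipBackground FadingMemory)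
open T4BoundaryCarrier (BFunctional atFl NE9Fl LipBackgroundFl NE5B)
open T4TowerRateComposition (PolyLipGrowth URateUpTo)
open T4CauchySum (InjectedRate)
open T4RecentScale T4GoodClassBudget T4TermwiseBudget T4TermwiseUN T4TermwiseChainUN
open AveragingDeficitPeriodicCounting (IsPeriodicDir)
open AveragingDeficitTwoLevelPrep (twoLevelSmall)
open NE3EnergyShapes (residualScale IsUnitarySite IsPeriodicSite)
open NE3EnergyWeightedShapes (energyNormW)
open NE7EtaBackgroundCarrier
open TorusSmallFieldGlobalGauge (sectorConst)
open TermwiseBackground (cReg)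
open TermwiseHolder (Realises)
open T4TermwiseTorus (IsPeriodic pbox)
open TermwiseLocal (goodClause_summable_UN_levels_of_thm1At_residualW)
open NE7EtaBackgroundAllCutoffs (endTowers_spec_occCarriers_of_hmin_all)

noncomputable section

variable {n : Type} [Fintype n] [DecidableEq n] [Nonempty n]

/-- **ROUTE #1's END DOCKED ON NODE O's BACKGROUND COORDINATE — `CruxDecl_of`'s seam END ∘ node T ∘ NODE O as ONE theorem.**  From (A) the
bill of the background coordinate (NE3's covariant root amendment 4 with ANY real constants; NE3's (H∃) `hmin`; `0 ≤ b ≤ ε`,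
`512·5·8·L²·b ≤ 1`, `16·C₀·ε ≤ 3`, `2·twoLevelSmall 4 L·ε ≤ L²`, `gradConst 4 c ≤ g`; `hdom`; the sector condition; `v₁ ∈ dom`), (B) node U2's
`InjectedRate` + window∕box∕moduli∕rate letters, (C) node U3's shapes for the six functionals on the carrier, and (D) the term-wise END's own
remaining binders — the eight selection-reading ones (`hfmtA hfmtB hint hoff hS hRSA hRSB hWw′`) FOR EVERY selection meeting the gen-56
specification, all others VERBATIM — conclude `∃ δ, GoodClause l₀ vol T A B Bad δ ∧ Summable δ` (the END's `δ⁗` at the produced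
`Cr, EB₀, CrR`).  Proof: `endTowers_spec_occCarriers_of_hmin_all`, then the END.  Every analytic input is a hypothesis; nothing printed is
asserted; NOT NE7. [folklore] -/
theorem goodClause_summable_of_route1_docked
    -- (A) the bill of NODE O's background coordinate
    {L N : ℕ} (hL : 2 ≤ L) (hN : 1 ≤ N) {θ : ℝ} (hθ : 0 < θ)
    (hθ6 : θ ^ 6 = ((L : ℝ))⁻¹) {ε b c : ℝ} (hb : 0 ≤ b) (hbε : b ≤ ε)
    (hbs : 512 * (4 + 1) * (4 + 4) * (L : ℝ) ^ 2 * b ≤ 1)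
    (hε1 : 16 * C0 4 * ε ≤ 3) (h2line : 2 * twoLevelSmall 4 L * ε ≤ (L : ℝ) ^ 2)
    {g C Λ₁ Λ₂' : ℝ} (hgc : gradConst 4 c ≤ g)
    {dom : Set (Site 4 → Fin 4 → (Matrix n n ℂ)ˣ)}
    (hdom : ∀ v ∈ dom, ∀ w : Site 4 → (Matrix n n ℂ)ˣ, IsUnitarySite w → IsPeriodicSite w (N : ℤ) → gaugeAct w v ∈ dom)
    (hmin : ∀ V ∈ dom, ∀ k : ℕ, ∃ U, IsMinimiser 4 (sfClass 4 L N ε) L N k V U ∧ RegularSup 4 L N b c k U)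
    (h : ∀ k : ℕ, 1 ≤ k → ∀ V ∈ dom, ∀ UA UB : (Site 4 → Fin 4 → (Matrix n n ℂ)ˣ),
      IsMinimiser 4 (sfClass 4 L N ε) L N k V UA → IsMinimiser 4 (sfClass 4 L N ε) L N (k + 1) V UB →
        Regular 4 L N b g (k + 1) UB →
        ∃ (u : Site 4 → (Matrix n n ℂ)ˣ) (Z : Site 4 → Fin 4 → Matrix n n ℂ),
          IsUnitarySite u ∧ IsPeriodicSite u ((N * L ^ k : ℕ) : ℤ) ∧
          IsSkewDir Z ∧ IsPeriodicDir Z ((N * L ^ k : ℕ) : ℤ) ∧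
          gaugeAct u UA = vary (rescale L (bavg L UB)) Z 1 ∧
          energyNormW L k (rescale L (bavg L UB)) Z (periodBox (N * L ^ k)) ≤ C * residualScale 4 L N b g k ∧
          (∀ (κ : Fin 4) (x : Site 4) (μ : Fin 4),
            ‖Ad (rescale L (bavg L UB) (x + e κ) μ) (Z (x + e μ) κ) - Z x κ‖ ≤ Λ₁ * (((L : ℝ)⁻¹) ^ k) ^ 2) ∧
          (∀ (κ μ : Fin 4) (y : Site 4),
            ‖Ad (rescale L (bavg L UB) (y + e κ) μ)
                (Ad (rescale L (bavg L UB) (y + e κ + e μ) μ) (Z (y + (2 : ℕ) • e μ) κ) - Z (y + e μ) κ)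
              - (Ad (rescale L (bavg L UB) (y + e κ) μ) (Z (y + e μ) κ) - Z y κ)‖ ≤ Λ₂' * (((L : ℝ)⁻¹) ^ k) ^ 3))
    (hsector : (Fintype.card n : ℝ) * (N : ℝ) ^ 2 * ε ≤ sectorConst n)
    {v₁ : (Site 4 → Fin 4 → (Matrix n n ℂ)ˣ)} (hv₁ : v₁ ∈ dom)
    (D : Type) (sc : D → ℕ) (dl : D → ℝ) (hdl : ∀ X, 0 ≤ dl X) (Fl : Type) (admFl : Set Fl)
    -- (B) window, decay, history moduli, node U2's output on the printed box, the common rate `θ′ ∈ [θ, 1)`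
    {W : Set (ℕ → ℝ)} {κ C₉ ω θc Cd γg θ' : ℝ} {Λ : ℕ → ℕ → ℝ} {gA : ℕ → ℕ → ℝ}
    (hΛ : FadingMemory C₉ ω Λ) (hω : 0 ≤ ω)
    (hinj : InjectedRate Cd 0 θc (fun K j => T4CouplingMatching.disc (gA K) (gA (K + 1)) j)) (hCd : 0 ≤ Cd)
    (hθc : 0 ≤ θc) (hbox : ∀ K i, i ≤ K → 0 < gA K i ∧ gA K i ≤ γg)
    (hgAW : ∀ K, gA K ∈ W) (hgBW : ∀ K, (fun i => gA (K + 1) (i + 1)) ∈ W)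
    (hθ' : max ω θc < θ') (hθθ' : θ ≤ θ') (hθ'1 : θ' < 1)
    -- (C) node U3's shapes: E-kind `EA EB`, boundary kind `BA BB`, 𝐑-kind `RA RB` on the boundary carrier over `occCarriers`
    {EA : Functional ({ toCarriers := occCarriers n L N ε dom D sc dl hdl, Fl := Fl, admFl := admFl } :
        T4BoundaryCarrier.Carriers).toCarriers (occCarriers n L N ε dom D sc dl hdl).BgA}
    {EB : Functional ({ toCarriers := occCarriers n L N ε dom D sc dl hdl, Fl := Fl, admFl := admFl } :
        T4BoundaryCarrier.Carriers).toCarriers (occCarriers n L N ε dom D sc dl hdl).BgB}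
    {θ₅ C₅ P : ℝ} {q : ℕ} {CU : (ℕ → ℝ) → ℕ → ℝ}
    (h9 : NE9 EA W κ Λ) (hU : LipBackground EA W κ CU) (hG : PolyLipGrowth CU gA P q) (hP : 0 ≤ P)
    (h5 : NE5 EA EB W κ θ₅ C₅) (hθ₅ : 0 ≤ θ₅) (hC₅ : 0 ≤ C₅) (hθ₅' : θ₅ ≤ θ')
    {BA : BFunctional ({ toCarriers := occCarriers n L N ε dom D sc dl hdl, Fl := Fl, admFl := admFl } : T4BoundaryCarrier.Carriers)
        (occCarriers n L N ε dom D sc dl hdl).BgA}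
    {BB : BFunctional ({ toCarriers := occCarriers n L N ε dom D sc dl hdl, Fl := Fl, admFl := admFl } : T4BoundaryCarrier.Carriers)
        (occCarriers n L N ε dom D sc dl hdl).BgB}
    {θ₅B C₅B PB : ℝ} {qB : ℕ} {CUB : (ℕ → ℝ) → ℕ → ℝ}
    (h9B : NE9Fl BA W κ Λ) (hUBf : LipBackgroundFl BA W κ CUB) (hGB : PolyLipGrowth CUB gA PB qB) (hPB : 0 ≤ PB)
    (h5B : NE5B BA BB W κ θ₅B C₅B) (hθ₅B : 0 ≤ θ₅B) (hC₅B : 0 ≤ C₅B) (hθ₅B' : θ₅B ≤ θ')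
    {RA : Functional ({ toCarriers := occCarriers n L N ε dom D sc dl hdl, Fl := Fl, admFl := admFl } :
        T4BoundaryCarrier.Carriers).toCarriers (occCarriers n L N ε dom D sc dl hdl).BgA}
    {RB : Functional ({ toCarriers := occCarriers n L N ε dom D sc dl hdl, Fl := Fl, admFl := admFl } :
        T4BoundaryCarrier.Carriers).toCarriers (occCarriers n L N ε dom D sc dl hdl).BgB}
    {θ₅R C₅R PR : ℝ} {qR : ℕ} {CUR : (ℕ → ℝ) → ℕ → ℝ}
    (h9R : NE9 RA W κ Λ) (hUR' : LipBackground RA W κ CUR) (hGR : PolyLipGrowth CUR gA PR qR) (hPR : 0 ≤ PR)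
    (h5R : NE5 RA RB W κ θ₅R C₅R) (hθ₅R : 0 ≤ θ₅R) (hC₅R : 0 ≤ C₅R) (hθ₅R' : θ₅R ≤ θ')
    -- (D) the term-wise END's own data and remaining binders (`TermwiseLocalThm1LedgerW` ll.97–242, `ι :=` configurations, `Adm := dom`)
    [MeasurableSpace (Site 4 → Fin 4 → (Matrix n n ℂ)ˣ)] {σ : Type*} [DecidableEq σ] {l₀ vol : ℝ}
    {T : ℕ → Finset σ} {Bad : ℕ → ℝ → Finset σ} {A B : ℕ → ℝ → σ → ℝ} {μ : ℕ → ℝ → σ → Measure (Site 4 → Fin 4 → (Matrix n n ℂ)ˣ)}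
    {fac bfac rfac : ℕ → ℝ → σ → Finset D} {R₁ bβ β' w₀ : ℝ} {κ₀ : ℕ} {gfA gfB : ℕ → ℝ} {gsA gsB : ℕ → ℕ → ℝ}
    {pend : ℕ → ℝ → σ → (Site 4 → Fin 4 → (Matrix n n ℂ)ˣ) → Fl}
    {nA nB aA aB wA wB γA γB : ℕ → ℝ → σ → (Site 4 → Fin 4 → (Matrix n n ℂ)ˣ) → ℝ} {qA qB : ℕ → ℝ}
    {κ₁ S : ℕ → ℝ → σ → ℕ → ℝ} {cW' RW' : ℕ → ℝ → σ → ℝ} {rw' sw' rγ zA zB c₀' : ℕ → ℝ} {Cw E a Λg Cl CF Ew CrW : ℝ}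
    {Y YA : Type*} {Sfib : ℕ → ℝ → σ → (Site 4 → Fin 4 → (Matrix n n ℂ)ˣ) → Set Y}
    {SfibA : ℕ → ℝ → σ → (Site 4 → Fin 4 → (Matrix n n ℂ)ˣ) → Set YA} {gfib : ℕ → ℝ → σ → (Site 4 → Fin 4 → (Matrix n n ℂ)ˣ) → YA → ℝ}
    {f₁ : ℕ → ℝ → σ → (Site 4 → Fin 4 → (Matrix n n ℂ)ˣ) → Y → ℝ}
    {Q : ℕ → ℝ → σ → (Site 4 → Fin 4 → (Matrix n n ℂ)ˣ) → Y → YA} {yA yB : ℕ → ℝ → σ → (Site 4 → Fin 4 → (Matrix n n ℂ)ˣ) → Y}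
    {xA : ℕ → ℝ → σ → (Site 4 → Fin 4 → (Matrix n n ℂ)ˣ) → YA}
    (M : ℕ) (hMtwo : 2 ≤ M) (planes : Finset (Fin 4 × Fin 4))
    (hplanes : ∀ P ∈ planes, P.1 ≠ P.2)
    (famA famB : ℕ → ℝ → σ → (Site 4 → Fin 4 → (Matrix n n ℂ)ˣ) → VarProblem)
    (ρA : ∀ K t τ v, Realises (famA K t τ v) 4 (Matrix n n ℂ)) (ρB : ∀ K t τ v, Realises (famB K t τ v) 4 (Matrix n n ℂ))
    (UA : ∀ K t τ v, (famA K t τ v).Cfg) (UB : ∀ K t τ v, (famB K t τ v).Cfg)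
    (lvlA lvlB : ℕ → ℝ → σ → (Site 4 → Fin 4 → (Matrix n n ℂ)ˣ) → (Fin 4 × Fin 4) × B7Prop1Explicit.Site 4 → ℕ)
    (Cst : B11Thm1.Consts) {Mc ε₁ β₀ : ℝ}
    (hθ'Λ : θ' ≤ Λg) (hΛ1 : 1 ≤ Λg) (hCl : 0 ≤ Cl)
    -- the residue of the residual-proper factor (W-fmt), read by `hWw′` below
    (wA' wB' : ℕ → ℝ → σ → (Site 4 → Fin 4 → (Matrix n n ℂ)ˣ) → ℝ)
    -- THE EIGHT SELECTION-READING BINDERS, for EVERY selection with the gen-56 specification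
    (hO : ∀ (uA : ℕ → (Site 4 → Fin 4 → (Matrix n n ℂ)ˣ) → (occCarriers n L N ε dom D sc dl hdl).BgA)
        (uB : ℕ → (Site 4 → Fin 4 → (Matrix n n ℂ)ˣ) → (occCarriers n L N ε dom D sc dl hdl).BgB)
        (oneA : (occCarriers n L N ε dom D sc dl hdl).BgA) (oneB : (occCarriers n L N ε dom D sc dl hdl).BgB),
      -- (a) gauge copies of a minimiser pair for the datum itself, at EVERY cutoff, on `dom ∖ {v₁}`
      (∀ K : ℕ, ∀ v ∈ dom, v ≠ v₁ → ∃ (U₁ U₂ : (Site 4 → Fin 4 → (Matrix n n ℂ)ˣ)) (w₁ w₂ : Site 4 → (Matrix n n ℂ)ˣ),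
        IsMinimiser 4 (sfClass 4 L N ε) L N K v U₁ ∧ IsMinimiser 4 (sfClass 4 L N ε) L N (K + 1) v U₂ ∧
        Regular 4 L N b g (K + 1) U₂ ∧ IsUnitarySite w₁ ∧ IsPeriodicSite w₁ ((N * L ^ K : ℕ) : ℤ) ∧
        IsUnitarySite w₂ ∧ IsPeriodicSite w₂ ((N * L ^ (K + 1) : ℕ) : ℤ) ∧
        (uA K v).1 = (K, gaugeAct w₁ U₁) ∧ (uB K v).1 = (K, gaugeAct w₂ U₂)) →
      -- (b) the reference backgrounds at `v₁` and off `dom`; they are the flat configuration at tag `0`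
      (∀ (K : ℕ) (v : (Site 4 → Fin 4 → (Matrix n n ℂ)ˣ)), ¬ (v ∈ dom ∧ v ≠ v₁) → uA K v = oneA ∧ uB K v = oneB) →
      oneA.1 = ((0 : ℕ), (1 : Site 4 → Fin 4 → (Matrix n n ℂ)ˣ)) → oneB.1 = ((0 : ℕ), (1 : Site 4 → Fin 4 → (Matrix n n ℂ)ˣ)) →
      -- `hfmtA` (l.97)
      (∀ K t τ, A K t τ = ∫ v, (∏ X ∈ fac K t τ,
        Real.exp (EA (gA K) (uA K v) X - EA (gA K) oneA X)) *
          ((∏ X ∈ bfac K t τ, Real.exp (BA (gA K) (uA K v) (pend K t τ v) X)) * nA K t τ v * qA K *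
            ((∏ X ∈ rfac K t τ, Real.exp (RA (gA K) (uA K v) X - RA (gA K) oneA X)) * (Real.exp (-aA K t τ v) * wA K t τ v)))
            ∂(μ K t τ)) ∧
      -- `hfmtB` (l.102)
      (∀ K t τ, B K t τ = ∫ v, (∏ X ∈ fac K t τ,
        Real.exp (EB (fun i => gA (K + 1) (i + 1)) (uB K v) X - EB (fun i => gA (K + 1) (i + 1)) oneB X)) *
          ((∏ X ∈ bfac K t τ, Real.exp (BB (fun i => gA (K + 1) (i + 1)) (uB K v) (pend K t τ v) X)) * nB K t τ v * qB K *
            ((∏ X ∈ rfac K t τ, Real.exp (RB (fun i => gA (K + 1) (i + 1)) (uB K v) X - RB (fun i => gA (K + 1) (i + 1)) oneB X)) *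
              (Real.exp (-aB K t τ v) * wB K t τ v)))
            ∂(μ K t τ)) ∧
      -- `hint` (l.107)
      (∀ K t, |t| ≤ l₀ → ∀ τ ∈ T K \ Bad K t,
        Integrable (fun v => (∏ X ∈ fac K t τ, Real.exp (EA (gA K) (uA K v) X - EA (gA K) oneA X)) *
          ((∏ X ∈ bfac K t τ, Real.exp (BA (gA K) (uA K v) (pend K t τ v) X)) * nA K t τ v * qA K *
            ((∏ X ∈ rfac K t τ, Real.exp (RA (gA K) (uA K v) X - RA (gA K) oneA X)) * (Real.exp (-aA K t τ v) * wA K t τ v))))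
            (μ K t τ) ∧
        Integrable (fun v => (∏ X ∈ fac K t τ,
            Real.exp (EB (fun i => gA (K + 1) (i + 1)) (uB K v) X - EB (fun i => gA (K + 1) (i + 1)) oneB X)) *
          ((∏ X ∈ bfac K t τ, Real.exp (BB (fun i => gA (K + 1) (i + 1)) (uB K v) (pend K t τ v) X)) * nB K t τ v * qB K *
            ((∏ X ∈ rfac K t τ, Real.exp (RB (fun i => gA (K + 1) (i + 1)) (uB K v) X - RB (fun i => gA (K + 1) (i + 1)) oneB X)) *
              (Real.exp (-aB K t τ v) * wB K t τ v))))
            (μ K t τ)) ∧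
      -- `hoff` (l.117)
      (∀ K t, |t| ≤ l₀ → ∀ τ ∈ T K \ Bad K t, ∀ v, v ∉ dom →
        (∏ X ∈ fac K t τ, Real.exp (EA (gA K) (uA K v) X - EA (gA K) oneA X)) *
          ((∏ X ∈ bfac K t τ, Real.exp (BA (gA K) (uA K v) (pend K t τ v) X)) * nA K t τ v * qA K *
            ((∏ X ∈ rfac K t τ, Real.exp (RA (gA K) (uA K v) X - RA (gA K) oneA X)) * (Real.exp (-aA K t τ v) * wA K t τ v)))
            = 0 ∧
        (∏ X ∈ fac K t τ, Real.exp (EB (fun i => gA (K + 1) (i + 1)) (uB K v) X - EB (fun i => gA (K + 1) (i + 1)) oneB X)) *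
          ((∏ X ∈ bfac K t τ, Real.exp (BB (fun i => gA (K + 1) (i + 1)) (uB K v) (pend K t τ v) X)) * nB K t τ v * qB K *
            ((∏ X ∈ rfac K t τ, Real.exp (RB (fun i => gA (K + 1) (i + 1)) (uB K v) X - RB (fun i => gA (K + 1) (i + 1)) oneB X)) *
              (Real.exp (-aB K t τ v) * wB K t τ v)))
            = 0) ∧
      -- `hS` (l.126)
      (∀ K t, |t| ≤ l₀ → ∀ τ ∈ T K \ Bad K t, ∀ v ∈ dom, ∀ j ≤ K,
        |(∑ X ∈ fac K t τ with sc X = j,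
            (Real.log (Real.exp (EB (fun i => gA (K + 1) (i + 1)) (uB K v) X - EB (fun i => gA (K + 1) (i + 1)) oneB X))
              - Real.log (Real.exp (EA (gA K) (uA K v) X - EA (gA K) oneA X)))) - κ₁ K t τ j| ≤ S K t τ j) ∧
      -- `hRSA` (l.148), `hRSB` (l.150)
      (∀ K t, |t| ≤ l₀ → ∀ τ ∈ T K \ Bad K t, ∀ v ∈ dom, ∀ j ≤ K,
        |∑ X ∈ rfac K t τ with sc X = j, (RA (gA K) (uA K v) X - RA (gA K) oneA X)| ≤ vol * (R₁ * gsA K j ^ κ₀)) ∧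
      (∀ K t, |t| ≤ l₀ → ∀ τ ∈ T K \ Bad K t, ∀ v ∈ dom, ∀ j ≤ K,
        |∑ X ∈ rfac K t τ with sc X = j,
          (RB (fun i => gA (K + 1) (i + 1)) (uB K v) X - RB (fun i => gA (K + 1) (i + 1)) oneB X)| ≤ vol * (R₁ * gsB K j ^ κ₀)) ∧
      -- `hWw′` (l.222)
      (∀ K t, |t| ≤ l₀ → ∀ τ ∈ T K \ Bad K t, ∀ v ∈ dom, uA K v = oneA → uB K v = oneB →
        |Real.log (wB' K t τ v) - Real.log (wA' K t τ v) - c₀' K| ≤ vol * sw' K))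
    -- the END's selection-free binders, VERBATIM
    (hsc : ∀ K t, |t| ≤ l₀ → ∀ τ ∈ T K \ Bad K t, ∀ X ∈ fac K t τ, sc X ≤ K)
    (hM : ∀ K t, |t| ≤ l₀ → ∀ τ ∈ T K \ Bad K t,
      Multiplicity (fac K t τ) sc (fun X => Real.exp (-(κ * dl X))) Cw vol Λg K)
    (hvol : 0 ≤ vol) (hE : 0 ≤ E) (ha0 : 0 < a) (ha1 : a < 1)
    (hSle : ∀ K t, |t| ≤ l₀ → ∀ τ ∈ T K \ Bad K t, ∀ j ≤ K, S K t τ j ≤ vol * (E * a ^ (K - j)))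
    (hpend : ∀ K t, |t| ≤ l₀ → ∀ τ ∈ T K \ Bad K t, ∀ v ∈ dom, pend K t τ v ∈ admFl)
    (hBwin : ∀ K t, |t| ≤ l₀ → ∀ τ ∈ T K \ Bad K t, RecentOnly (bfac K t τ) sc (jlogOf Cl K) K)
    (hMB : ∀ K t, |t| ≤ l₀ → ∀ τ ∈ T K \ Bad K t,
      Multiplicity (bfac K t τ) sc (fun X => Real.exp (-(κ * dl X))) Cw vol Λg K)
    (hnpos : ∀ K t, |t| ≤ l₀ → ∀ τ ∈ T K \ Bad K t, ∀ v ∈ dom, 0 < nA K t τ v ∧ 0 < nB K t τ v)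
    (hzA : ∀ K t, |t| ≤ l₀ → ∀ τ ∈ T K \ Bad K t, ∀ v ∈ dom, |Real.log (nA K t τ v)| ≤ vol * zA K)
    (hzB : ∀ K t, |t| ≤ l₀ → ∀ τ ∈ T K \ Bad K t, ∀ v ∈ dom, |Real.log (nB K t τ v)| ≤ vol * zB K)
    (hzAs : Summable zA) (hzBs : Summable zB)
    (hq : ∀ K, 0 < qA K ∧ 0 < qB K)
    (hrsc : ∀ K t, |t| ≤ l₀ → ∀ τ ∈ T K \ Bad K t, ∀ X ∈ rfac K t τ, sc X ≤ K)
    (hMR : ∀ K t, |t| ≤ l₀ → ∀ τ ∈ T K \ Bad K t,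
      Multiplicity (rfac K t τ) sc (fun X => Real.exp (-(κ * dl X))) Cw vol Λg K)
    (hbβ : 0 < bβ) (h031A : ∀ K, Step.Discrete031 bβ β' K (gfA K) (gsA K))
    (h031B : ∀ K, Step.Discrete031 bβ β' K (gfB K) (gsB K)) (hgsA : ∀ K k, k ≤ K → 0 ≤ gsA K k)
    (hgsB : ∀ K k, k ≤ K → 0 ≤ gsB K k) (hR₁ : 0 ≤ R₁) (hκ₀ : 4 < κ₀)
    (hminA : ∀ K t, |t| ≤ l₀ → ∀ τ ∈ T K \ Bad K t, ∀ v ∈ dom, IsMinOn (gfib K t τ v) (SfibA K t τ v) (xA K t τ v))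
    (hQ : ∀ K t, |t| ≤ l₀ → ∀ τ ∈ T K \ Bad K t, ∀ v ∈ dom, Set.MapsTo (Q K t τ v) (Sfib K t τ v) (SfibA K t τ v))
    (hlift : ∀ K t, |t| ≤ l₀ → ∀ τ ∈ T K \ Bad K t, ∀ v ∈ dom,
      yA K t τ v ∈ Sfib K t τ v ∧ Q K t τ v (yA K t τ v) = xA K t τ v)
    (hminB : ∀ K t, |t| ≤ l₀ → ∀ τ ∈ T K \ Bad K t, ∀ v ∈ dom,
      yB K t τ v ∈ Sfib K t τ v ∧ IsMinOn (f₁ K t τ v) (Sfib K t τ v) (yB K t τ v))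
    (hact : ∀ K t, |t| ≤ l₀ → ∀ τ ∈ T K \ Bad K t, ∀ v ∈ dom,
      aA K t τ v = w₀ * gfib K t τ v (xA K t τ v) + γA K t τ v ∧
        aB K t τ v = w₀ * f₁ K t τ v (yB K t τ v) + γB K t τ v)
    (hw₀ : 0 ≤ w₀)
    (hAU : ∀ K t, |t| ≤ l₀ → ∀ τ ∈ T K \ Bad K t, ∀ v ∈ dom,
      (∀ x κ, (ρA K t τ v).cfg (UA K t τ v) x κ ∈ unitaryUnits (Matrix n n ℂ)) ∧
        IsPeriodic (M * L ^ K * L) ((ρA K t τ v).cfg (UA K t τ v)))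
    (hBU : ∀ K t, |t| ≤ l₀ → ∀ τ ∈ T K \ Bad K t, ∀ v ∈ dom,
      (∀ x κ, (ρB K t τ v).cfg (UB K t τ v) x κ ∈ unitaryUnits (Matrix n n ℂ)) ∧
        IsPeriodic (M * L ^ K * L) ((ρB K t τ v).cfg (UB K t τ v)))
    (hPLA : ∀ K t τ v, (famA K t τ v).L = (L : ℝ)) (hetaA : ∀ K t τ v, (famA K t τ v).eta = ((L : ℝ) ^ K)⁻¹)
    (hPLB : ∀ K t τ v, (famB K t τ v).L = (L : ℝ)) (hetaB : ∀ K t τ v, (famB K t τ v).eta = ((L : ℝ) ^ K)⁻¹)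
    (hTA : ∀ K t τ v, B11Thm1.Thm1At Cst (famA K t τ v)) (hTB : ∀ K t τ v, B11Thm1.Thm1At Cst (famB K t τ v))
    (hε₁a : ε₁ ≤ Cst.a₁) (VbA : ∀ K t τ v, (famA K t τ v).Bdry) (VbB : ∀ K t τ v, (famB K t τ v).Bdry)
    (hVbA : ∀ K t τ v, (famA K t τ v).Reg7 ε₁ (VbA K t τ v)) (hVbB : ∀ K t τ v, (famB K t τ v).Reg7 ε₁ (VbB K t τ v))
    (hUA : ∀ K t τ v, (famA K t τ v).OnMinimalOrbit (Cst.B₃ * ε₁) (VbA K t τ v) (UA K t τ v))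
    (hUB : ∀ K t τ v, (famB K t τ v).OnMinimalOrbit (Cst.B₃ * ε₁) (VbB K t τ v) (UB K t τ v))
    (hMc0 : 0 ≤ Mc) (hMc : Mc ≤ Cst.Mfun ε₁)
    (hlvlA : ∀ K t τ v, ∀ y ∈ pbox planes (M * L ^ K), lvlA K t τ v y ≤ K)
    (hlvlB : ∀ K t τ v, ∀ y ∈ pbox planes (M * L ^ K), lvlB K t τ v y ≤ K)
    (hcoverA : ∀ K t, |t| ≤ l₀ → ∀ τ ∈ T K \ Bad K t, ∀ v ∈ dom, ∀ y ∈ pbox planes (M * L ^ K),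
      ∀ x : B7Prop1Explicit.Site 4, InBox ((L : ℤ) • y.2) (deltaHi L ((L : ℤ) • y.2) y.1.1 y.1.2) x →
        ∃ cb : (famA K t τ v).Cube, (famA K t τ v).scale cb = lvlA K t τ v y ∧ (famA K t τ v).sizeM cb ≤ Mc ∧
          l1 (x - (ρA K t τ v).centre cb) + 6 ≤ (ρA K t τ v).radius cb)
    (hcoverB : ∀ K t, |t| ≤ l₀ → ∀ τ ∈ T K \ Bad K t, ∀ v ∈ dom, ∀ y ∈ pbox planes (M * L ^ K),
      ∀ x : B7Prop1Explicit.Site 4, InBox ((L : ℤ) • y.2) (deltaHi L ((L : ℤ) • y.2) y.1.1 y.1.2) x →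
        ∃ cb : (famB K t τ v).Cube, (famB K t τ v).scale cb = lvlB K t τ v y ∧ (famB K t τ v).sizeM cb ≤ Mc ∧
          l1 (x - (ρB K t τ v).centre cb) + 6 ≤ (ρB K t τ v).radius cb)
    (hwinA : ∀ K t, |t| ≤ l₀ → ∀ τ ∈ T K \ Bad K t, ∀ v ∈ dom,
      RecentOnly (pbox planes (M * L ^ K)) (lvlA K t τ v) (jlogOf Cl K) K)
    (hwinB : ∀ K t, |t| ≤ l₀ → ∀ τ ∈ T K \ Bad K t, ∀ v ∈ dom,
      RecentOnly (pbox planes (M * L ^ K)) (lvlB K t τ v) (jlogOf Cl K) K)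
    (hε₁ : 0 < ε₁) (hε₁1 : ε₁ ≤ 1)
    (hsmall : 20480 * (L : ℝ) ^ 2 * (cReg (Cst.B₃ * Mc) (Cst.B₃ * Mc) * ε₁) ≤ 1) (hβ₀ : 0 < β₀) (hβ₀1 : β₀ ≤ 1)
    (hreprU : ∀ K t, |t| ≤ l₀ → ∀ τ ∈ T K \ Bad K t, ∀ v ∈ dom,
      f₁ K t τ v (yA K t τ v) = ∑ x ∈ pbox planes (M * L ^ K * L), eN (phiU ((ρA K t τ v).cfg (UA K t τ v)) x) ∧
        gfib K t τ v (xA K t τ v) = ∑ y ∈ pbox planes (M * L ^ K), eN (psiU L ((ρA K t τ v).cfg (UA K t τ v)) y))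
    (hreprL : ∀ K t, |t| ≤ l₀ → ∀ τ ∈ T K \ Bad K t, ∀ v ∈ dom,
      f₁ K t τ v (yB K t τ v) = ∑ x ∈ pbox planes (M * L ^ K * L), eN (phiU ((ρB K t τ v).cfg (UB K t τ v)) x) ∧
        gfib K t τ v (Q K t τ v (yB K t τ v)) = ∑ y ∈ pbox planes (M * L ^ K), eN (psiU L ((ρB K t τ v).cfg (UB K t τ v)) y))
    (hMvol : ((M : ℝ)) ^ 4 ≤ vol)
    (hγ : ∀ K t, |t| ≤ l₀ → ∀ τ ∈ T K \ Bad K t, ∀ v ∈ dom, |γB K t τ v - γA K t τ v| ≤ vol * rγ K)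
    (hrγ : Summable rγ)
    -- the residual-proper factor's format (W-fmt) and inputs (W-sc)(W-loc)(W-size)(W-rate-t)(W-mult-F)(W-win)(W-rate-0)(W-mult)
    (wfac nf : ℕ → ℝ → σ → Finset D) (wfac₀ : ℕ → Finset D)
    (vcA vcB : ℕ → ℝ → D → ℝ) (hEw : 0 ≤ Ew) (hCrW : 0 ≤ CrW)
    (hwA : ∀ K t, |t| ≤ l₀ → ∀ τ ∈ T K \ Bad K t, ∀ v ∈ dom,
      wA K t τ v = wA' K t τ v * Real.exp (∑ X ∈ wfac K t τ, vcA K t X))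
    (hwB : ∀ K t, |t| ≤ l₀ → ∀ τ ∈ T K \ Bad K t, ∀ v ∈ dom,
      wB K t τ v = wB' K t τ v * Real.exp (∑ X ∈ wfac K t τ, vcB K t X))
    (hw'pos : ∀ K t, |t| ≤ l₀ → ∀ τ ∈ T K \ Bad K t, ∀ v ∈ dom, 0 < wA' K t τ v ∧ 0 < wB' K t τ v)
    (hRw' : ∀ K t, |t| ≤ l₀ → ∀ τ ∈ T K \ Bad K t, ∀ v ∈ dom,
      |Real.log (wB' K t τ v) - Real.log (wA' K t τ v) - cW' K t τ| ≤ RW' K t τ)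
    (hRRw' : ∀ K t, |t| ≤ l₀ → ∀ τ ∈ T K \ Bad K t, RW' K t τ ≤ vol * rw' K) (hrw' : Summable rw')
    (hsw' : Summable sw')
    (hWsc : ∀ K t, |t| ≤ l₀ → ∀ τ ∈ T K \ Bad K t, ∀ X ∈ wfac K t τ, sc X ≤ K)
    (hWsc₀ : ∀ K, ∀ X ∈ wfac₀ K, sc X ≤ K)
    (hWloc : ∀ K t, |t| ≤ l₀ → ∀ τ ∈ T K \ Bad K t, ∀ X ∈ wfac K t τ, X ∉ nf K t τ →
      vcA K t X = vcA K 0 X ∧ vcB K t X = vcB K 0 X)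
    (hWsize : ∀ K t, |t| ≤ l₀ → ∀ τ ∈ T K \ Bad K t, ∀ j ≤ K,
      ∑ X ∈ wfac K t τ with sc X = j, (|vcA K t X - vcA K 0 X| + |vcB K t X - vcB K 0 X|)
        ≤ vol * (Ew * a ^ (K - j)))
    (hWratet : ∀ K t, |t| ≤ l₀ → ∀ τ ∈ T K \ Bad K t, ∀ X ∈ wfac K t τ, X ∈ nf K t τ →
      |(vcB K t X - vcB K 0 X) - (vcA K t X - vcA K 0 X)| ≤ CrW * θ' ^ sc X * Real.exp (-(κ * dl X)))
    (hWMF : ∀ K t, |t| ≤ l₀ → ∀ τ ∈ T K \ Bad K t,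
      Multiplicity (nf K t τ) sc (fun X => Real.exp (-(κ * dl X))) CF vol Λg K)
    (hWwin : ∀ K t, |t| ≤ l₀ → ∀ τ ∈ T K \ Bad K t, ∀ X ∈ wfac K t τ, X ∉ wfac₀ K → jlogOf Cl K ≤ sc X)
    (hWwin₀ : ∀ K t, |t| ≤ l₀ → ∀ τ ∈ T K \ Bad K t, ∀ X ∈ wfac₀ K, X ∉ wfac K t τ → jlogOf Cl K ≤ sc X)
    (hWrate0 : ∀ K t, |t| ≤ l₀ → ∀ τ ∈ T K \ Bad K t, ∀ X ∈ wfac K t τ,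
      |vcB K 0 X - vcA K 0 X| ≤ CrW * θ' ^ sc X * Real.exp (-(κ * dl X)))
    (hWrate0' : ∀ K, ∀ X ∈ wfac₀ K, |vcB K 0 X - vcA K 0 X| ≤ CrW * θ' ^ sc X * Real.exp (-(κ * dl X)))
    (hWM : ∀ K t, |t| ≤ l₀ → ∀ τ ∈ T K \ Bad K t,
      Multiplicity (wfac K t τ) sc (fun X => Real.exp (-(κ * dl X))) Cw vol Λg K)
    (hWM₀ : ∀ K, Multiplicity (wfac₀ K) sc (fun X => Real.exp (-(κ * dl X))) Cw vol Λg K) :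
    ∃ δ : ℕ → ℝ, GoodClause l₀ vol T A B Bad δ ∧ Summable δ := by
  -- NODE O's background coordinate × node T: the selections, their specification, the four background binders (gen 56)
  obtain ⟨uA, uB, Cr, EB₀, CrR, hspec, hoff0, hCr, hEB₀, hCrR, hUR, hURB, hURR, hwit⟩ :=
    endTowers_spec_occCarriers_of_hmin_all hL hN hθ hθ6 hb hbε hbs hε1 h2line hgc hdom hmin h hsector hv₁ D sc dl hdl Fl admFl
      hΛ hω hinj hCd hθc hbox hgAW hgBW hθ' hθθ' h9 hU hG hP h5 hθ₅ hC₅ hθ₅' h9B hUBf hGB hPB h5B hθ₅B hC₅B hθ₅B'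
      h9R hUR' hGR hPR h5R hθ₅R hC₅R hθ₅R'
  -- the eight selection-reading binders at THESE selections (reference backgrounds = the flat configuration at tag `0`)
  obtain ⟨hfmtA, hfmtB, hint, hoff, hS, hRSA, hRSB, hWw'⟩ := hO uA uB _ _ hspec hoff0 rfl rfl
  have hθ'0 : 0 < θ' := lt_of_lt_of_le hθ hθθ'
  -- the END
  exact ⟨_, goodClause_summable_UN_levels_of_thm1At_residualW
    (C := ({ toCarriers := occCarriers n L N ε dom D sc dl hdl, Fl := Fl, admFl := admFl } : T4BoundaryCarrier.Carriers))
    M L hMtwo hL planes hplanes famA famB ρA ρB UA UB lvlA lvlB Cst hUR hCr hθ'0 hθ'1 hθ'Λ hΛ1 hCl hURB hEB₀ hURR hCrR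
    hfmtA hfmtB hint hsc hoff hS hM hwit hvol hE ha0 ha1 hSle hpend hBwin hMB hnpos hzA hzB hzAs hzBs hq hrsc hMR hRSA hRSB hbβ
    h031A h031B hgsA hgsB hR₁ hκ₀ hminA hQ hlift hminB hact hw₀ hAU hBU hPLA hetaA hPLB hetaB hTA hTB hε₁a VbA VbB hVbA hVbB
    hUA hUB hMc0 hMc hlvlA hlvlB hcoverA hcoverB hwinA hwinB hε₁ hε₁1 hsmall hβ₀ hβ₀1 hreprU hreprL hMvol hγ hrγ wA' wB' wfac nf
    wfac₀ vcA vcB hEw hCrW hwA hwB hw'pos hRw' hRRw' hrw' hWw' hsw' hWsc hWsc₀ hWloc hWsize hWratet hWMF hWwin hWwin₀ hWrate0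
    hWrate0' hWM hWM₀⟩

end

end Summit.QuantumFields.BalabanUV.T4Continuum.NE7Route1EndDocked
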